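import Summits.HubbardSuperconductivity.HubbardSuperconductivity.Theorems.TwTipContinuation.Negative.TipNormalForm
import Summits.HubbardSuperconductivity.HubbardSuperconductivity.Theorems.ThermalWedgeTwTipContinuationEdgeOrderProductState
import Literature.MathematicalPhysics.QuantumLattice.TorusCooperSum

/-!
# `TwTipContinuation` (stmt-HubbardSuperconductivity-1700), line `isogap-submodular-transport`,
# stub `stub_edgeOrder` — piece 3a(iii): commutators of the seeded free torus with a two-mode creator

For `A_{kq} = c†_{k↑} c†_{q↓}` on the fermionic torus `(ℤ/Lℤ)²`:
* `[Σ_{k'σ} f(k') n_{k'σ}, A_{kq}] = (f(k) + f(q)) A_{kq}`, hence `[T, A_{kq}] = (ε_L(k)+ε_L(q)) A_{kq}`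
  for the free torus `T = hubbardTorus 2 L 1 0` (`L ≥ 3`);
* `[B, A_{kq}] = ĝ(k) c_{−k↓} c†_{q↓} − ĝ(−q) c†_{k↑} c_{−q↑}` for the pair operator
  `B = pairOperator ĝ univ = Σ_p ĝ(p) b_p`, and `Bᴴ A_{kq} = A_{kq} Bᴴ`;
* consequently, for `H = T − γ Δᴴ Δ` with `Δ = −(2√2)•B` (`pairField_dWave_eq_smul_pairOperator`),
  `H A − A H = (ε_k+ε_q) A − γ Δᴴ (Δ A − A Δ)` with `Δ A − A Δ = −(2√2)•[B, A]`.
Folklore CAR identities (Bratteli–Robinson II §5.2.2).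
-/

noncomputable section

namespace Summit.HubbardSuperconductivity.TwTipContinuation.IsogapTransport

open Matrix Finset
open Literature.MathematicalPhysics.QuantumLattice Literature.Probability.LatticeModels
open scoped ComplexOrder ComplexConjugate

variable {L : ℕ} [NeZero L]

/-! ### One-body operators -/

/-- `[n_{k'σ'}, c†_{kσ}] = δ c†_{kσ}`. [folklore] -/
theorem momentumNumber_commutator_momentumCreation (k' k : TorusSite 2 L) (σ' σ : Fin 2) :
    momentumNumber k' σ' * momentumCreation k σ - momentumCreation k σ * momentumNumber k' σ' =
      if k' = k ∧ σ' = σ then momentumCreation k σ else 0 := by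
  by_cases h : k' = k ∧ σ' = σ
  · obtain ⟨rfl, rfl⟩ := h
    rw [if_pos ⟨rfl, rfl⟩, momentumNumber_mul_momentumCreation_self, momentumNumber, ← Matrix.mul_assoc,
      momentumCreation_mul_self, Matrix.zero_mul, sub_zero]
  · rw [if_neg h, momentumNumber_mul_momentumCreation_of_ne h, sub_self]

/-- `[Σ_{k'σ'} f(k') n_{k'σ'}, c†_{kσ}] = f(k) c†_{kσ}`. [folklore] -/
theorem oneBody_commutator_momentumCreation (f : TorusSite 2 L → ℝ) (k : TorusSite 2 L) (σ : Fin 2) :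
    (∑ k' : TorusSite 2 L, ∑ σ' : Fin 2, ((f k' : ℝ) : ℂ) • momentumNumber k' σ') * momentumCreation k σ -
        momentumCreation k σ * (∑ k' : TorusSite 2 L, ∑ σ' : Fin 2, ((f k' : ℝ) : ℂ) • momentumNumber k' σ') =
      ((f k : ℝ) : ℂ) • momentumCreation k σ := by
  simp only [Finset.sum_mul, Finset.mul_sum, smul_mul_assoc, mul_smul_comm, ← Finset.sum_sub_distrib, ← smul_sub,
    momentumNumber_commutator_momentumCreation]
  simp only [ite_and, smul_ite, smul_zero]
  rw [Finset.sum_eq_single_of_mem k (Finset.mem_univ k) (fun x _ hx => by simp [hx])]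
  simp only [if_true]
  rw [Finset.sum_ite_eq' Finset.univ σ, if_pos (Finset.mem_univ σ)]

/-- `[Σ_{k'σ'} f(k') n_{k'σ'}, c†_{k↑} c†_{q↓}] = (f(k) + f(q)) c†_{k↑} c†_{q↓}`. [folklore] -/
theorem oneBody_commutator_pairCreator (f : TorusSite 2 L → ℝ) (k q : TorusSite 2 L) :
    (∑ k' : TorusSite 2 L, ∑ σ' : Fin 2, ((f k' : ℝ) : ℂ) • momentumNumber k' σ') * (momentumCreation k 0 * momentumCreation q 1) -
        (momentumCreation k 0 * momentumCreation q 1) * (∑ k' : TorusSite 2 L, ∑ σ' : Fin 2, ((f k' : ℝ) : ℂ) • momentumNumber k' σ') =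
      ((f k + f q : ℝ) : ℂ) • (momentumCreation k 0 * momentumCreation q 1) := by
  rw [commutator_mul_expand, oneBody_commutator_momentumCreation, oneBody_commutator_momentumCreation, smul_mul_assoc,
    mul_smul_comm, ← add_smul, ← Complex.ofReal_add]

/-- **`[T, A_{kq}] = (ε_L(k) + ε_L(q)) A_{kq}`** for the free torus (`L ≥ 3`). [folklore] -/
theorem hubbardTorus_zero_commutator_pairCreator (hL : 3 ≤ L) (k q : TorusSite 2 L) :
    hubbardTorus 2 L 1 0 * (momentumCreation k 0 * momentumCreation q 1) -
        (momentumCreation k 0 * momentumCreation q 1) * hubbardTorus 2 L 1 0 =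
      ((torusBand L k + torusBand L q : ℝ) : ℂ) • (momentumCreation k 0 * momentumCreation q 1) := by
  rw [hubbardTorus_zero_eq_sum_momentumNumber hL]
  exact oneBody_commutator_pairCreator (torusBand L) k q

/-! ### The pair operator -/

/-- `b_p c†_{k↑} = c†_{k↑} b_p + δ_{pk} c_{−k↓}`. [folklore] -/
theorem pairMode_mul_momentumCreation_up (p k : TorusSite 2 L) :
    pairMode p * momentumCreation k 0 =
      momentumCreation k 0 * pairMode p + (if p = k then momentumAnnihilation (-k) 1 else 0) := by
  have h := congrArg conjTranspose (momentumAnnihilation_up_mul_pairCreator k p)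
  rw [conjTranspose_mul, conjTranspose_conjTranspose, momentumAnnihilation_conjTranspose, conjTranspose_add,
    conjTranspose_mul, conjTranspose_conjTranspose, momentumAnnihilation_conjTranspose] at h
  rw [h]
  congr 1
  by_cases hpk : p = k
  · subst hpk; rw [if_pos rfl, if_pos rfl, momentumCreation_conjTranspose]
  · rw [if_neg hpk, if_neg (Ne.symm hpk), conjTranspose_zero]

/-- `b_p c†_{q↓} = c†_{q↓} b_p − δ_{q,−p} c_{p↑}`. [folklore] -/
theorem pairMode_mul_momentumCreation_down (p q : TorusSite 2 L) :
    pairMode p * momentumCreation q 1 =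
      momentumCreation q 1 * pairMode p - (if q = -p then momentumAnnihilation p 0 else 0) := by
  have h := congrArg conjTranspose (momentumAnnihilation_down_mul_pairCreator q p)
  rw [conjTranspose_mul, conjTranspose_conjTranspose, momentumAnnihilation_conjTranspose, conjTranspose_sub,
    conjTranspose_mul, conjTranspose_conjTranspose, momentumAnnihilation_conjTranspose] at h
  rw [h]
  congr 1
  by_cases hq : q = -p
  · rw [if_pos hq, if_pos hq, momentumCreation_conjTranspose]
  · rw [if_neg hq, if_neg hq, conjTranspose_zero]

/-- `[B, c†_{k↑}] = ĝ(k) c_{−k↓}` for `B = Σ_p ĝ(p) b_p`. [folklore] -/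
theorem pairOperator_commutator_momentumCreation_up (g : TorusSite 2 L → ℝ) (k : TorusSite 2 L) :
    pairOperator g Finset.univ * momentumCreation k 0 - momentumCreation k 0 * pairOperator g Finset.univ =
      ((g k : ℝ) : ℂ) • momentumAnnihilation (-k) 1 := by
  simp only [pairOperator, Finset.sum_mul, Finset.mul_sum, smul_mul_assoc, mul_smul_comm, ← Finset.sum_sub_distrib,
    ← smul_sub, pairMode_mul_momentumCreation_up, add_sub_cancel_left, smul_ite, smul_zero, Finset.sum_ite_eq',
    Finset.mem_univ, if_true]

/-- `[B, c†_{q↓}] = −ĝ(−q) c_{−q↑}`. [folklore] -/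
theorem pairOperator_commutator_momentumCreation_down (g : TorusSite 2 L → ℝ) (q : TorusSite 2 L) :
    pairOperator g Finset.univ * momentumCreation q 1 - momentumCreation q 1 * pairOperator g Finset.univ =
      -(((g (-q) : ℝ) : ℂ) • momentumAnnihilation (-q) 0) := by
  simp only [pairOperator, Finset.sum_mul, Finset.mul_sum, smul_mul_assoc, mul_smul_comm, ← Finset.sum_sub_distrib,
    ← smul_sub, pairMode_mul_momentumCreation_down, sub_sub_cancel_left, smul_neg, Finset.sum_neg_distrib]
  congr 1
  have : ∀ p : TorusSite 2 L, (if q = -p then ((g p : ℝ) : ℂ) • momentumAnnihilation p 0 else 0) =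
      if p = -q then ((g (-q) : ℝ) : ℂ) • momentumAnnihilation (-q) 0 else 0 := by
    intro p
    by_cases h : p = -q
    · subst h; rw [if_pos (neg_neg q).symm, if_pos rfl]
    · rw [if_neg h, if_neg]; intro h'; exact h (by rw [h', neg_neg])
  simp only [smul_ite, smul_zero, this, Finset.sum_ite_eq', Finset.mem_univ, if_true]

/-- **`[B, A_{kq}] = ĝ(k) c_{−k↓} c†_{q↓} − ĝ(−q) c†_{k↑} c_{−q↑}`**. [folklore] -/
theorem pairOperator_commutator_pairCreator (g : TorusSite 2 L → ℝ) (k q : TorusSite 2 L) :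
    pairOperator g Finset.univ * (momentumCreation k 0 * momentumCreation q 1) -
        (momentumCreation k 0 * momentumCreation q 1) * pairOperator g Finset.univ =
      ((g k : ℝ) : ℂ) • (momentumAnnihilation (-k) 1 * momentumCreation q 1) -
        ((g (-q) : ℝ) : ℂ) • (momentumCreation k 0 * momentumAnnihilation (-q) 0) := by
  rw [commutator_mul_expand, pairOperator_commutator_momentumCreation_up, pairOperator_commutator_momentumCreation_down,
    smul_mul_assoc, mul_neg, mul_smul_comm, sub_eq_add_neg]

/-- `b†_p` commutes with every `c†_{kσ}` (even in the creators). [folklore] -/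
theorem pairCreator_mul_momentumCreation (p k : TorusSite 2 L) (σ : Fin 2) :
    (pairMode p)ᴴ * momentumCreation k σ = momentumCreation k σ * (pairMode p)ᴴ := by
  rw [pairMode_conjTranspose, Matrix.mul_assoc, momentumCreation_mul_eq_neg (-p) k 1 σ, mul_neg, ← Matrix.mul_assoc,
    momentumCreation_mul_eq_neg p k 0 σ, neg_mul, neg_neg, Matrix.mul_assoc]

/-- `Bᴴ A_{kq} = A_{kq} Bᴴ`. [folklore] -/
theorem pairOperator_conjTranspose_mul_pairCreator (g : TorusSite 2 L → ℝ) (k q : TorusSite 2 L) :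
    (pairOperator g Finset.univ)ᴴ * (momentumCreation k 0 * momentumCreation q 1) =
      (momentumCreation k 0 * momentumCreation q 1) * (pairOperator g Finset.univ)ᴴ := by
  rw [pairOperator, conjTranspose_sum, Finset.sum_mul, Finset.mul_sum]
  refine Finset.sum_congr rfl fun p _ => ?_
  rw [conjTranspose_smul, smul_mul_assoc, mul_smul_comm, ← Matrix.mul_assoc, pairCreator_mul_momentumCreation,
    Matrix.mul_assoc, pairCreator_mul_momentumCreation, Matrix.mul_assoc]

/-! ### The seeded Hamiltonian -/

/-- `[Xᴴ X, A] = Xᴴ [X, A]` whenever `Xᴴ A = A Xᴴ`. [folklore] -/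
theorem conjTranspose_mul_self_commutator {n : Type*} [Fintype n] (X A : Matrix n n ℂ) (h : Xᴴ * A = A * Xᴴ) :
    Xᴴ * X * A - A * (Xᴴ * X) = Xᴴ * (X * A - A * X) := by
  rw [Matrix.mul_sub, ← Matrix.mul_assoc A, ← h, Matrix.mul_assoc, Matrix.mul_assoc]

/-- **The commutator of the seeded free torus with the two-mode creator**:
`H A − A H = (ε_L(k)+ε_L(q)) A − γ Δᴴ (Δ A − A Δ)` for `H = T − γ ΔᴴΔ`, `Δ = pairField d L`. [folklore] -/
theorem seededH_commutator_pairCreator (hL : 3 ≤ L) (γ : ℂ) (k q : TorusSite 2 L) :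
    (hubbardTorus 2 L 1 0 - γ • ((pairField dWaveFormFactor L)ᴴ * pairField dWaveFormFactor L)) *
          (momentumCreation k 0 * momentumCreation q 1) -
        (momentumCreation k 0 * momentumCreation q 1) *
          (hubbardTorus 2 L 1 0 - γ • ((pairField dWaveFormFactor L)ᴴ * pairField dWaveFormFactor L)) =
      ((torusBand L k + torusBand L q : ℝ) : ℂ) • (momentumCreation k 0 * momentumCreation q 1) -
        γ • ((pairField dWaveFormFactor L)ᴴ *
          (pairField dWaveFormFactor L * (momentumCreation k 0 * momentumCreation q 1) -
            (momentumCreation k 0 * momentumCreation q 1) * pairField dWaveFormFactor L)) := by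
  have hcomm : (pairField dWaveFormFactor L)ᴴ * (momentumCreation k 0 * momentumCreation q 1) =
      (momentumCreation k 0 * momentumCreation q 1) * (pairField dWaveFormFactor L)ᴴ := by
    rw [pairField_dWave_eq_smul_pairOperator, conjTranspose_neg, conjTranspose_smul, neg_mul, mul_neg, smul_mul_assoc,
      mul_smul_comm, pairOperator_conjTranspose_mul_pairCreator]
  rw [Matrix.sub_mul, Matrix.mul_sub, sub_sub_sub_comm, hubbardTorus_zero_commutator_pairCreator hL, smul_mul_assoc,
    mul_smul_comm, ← smul_sub, conjTranspose_mul_self_commutator _ _ hcomm]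

/-- `Δ A − A Δ = −(2√2) • [B, A]` with `B = pairOperator dWaveGap univ`. [folklore] -/
theorem pairField_commutator_pairCreator (k q : TorusSite 2 L) :
    pairField dWaveFormFactor L * (momentumCreation k 0 * momentumCreation q 1) -
        (momentumCreation k 0 * momentumCreation q 1) * pairField dWaveFormFactor L =
      -(((2 * Real.sqrt 2 : ℝ) : ℂ) •
        (((dWaveGap k : ℝ) : ℂ) • (momentumAnnihilation (-k) 1 * momentumCreation q 1) -
          ((dWaveGap (-q) : ℝ) : ℂ) • (momentumCreation k 0 * momentumAnnihilation (-q) 0))) := by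
  rw [pairField_dWave_eq_smul_pairOperator, neg_mul, mul_neg, smul_mul_assoc, mul_smul_comm, ← smul_neg, ← smul_neg,
    ← smul_sub, ← pairOperator_commutator_pairCreator, ← smul_neg]
  congr 1
  abel

/-- **Commutator of the seeded free torus with the two-mode creator (piece 3a(iii) of
`stub_edgeOrder`)**, closed form. [folklore] -/
theorem pairAddition_commutator :
    ∀ (L : ℕ) [NeZero L], 3 ≤ L → ∀ (γ : ℂ) (k q : TorusSite 2 L), (hubbardTorus 2 L 1 0 - γ • ((pairField dWaveFormFactor L)ᴴ * pairField dWaveFormFactor L)) * (momentumCreation k 0 * momentumCreation q 1) - (momentumCreation k 0 * momentumCreation q 1) * (hubbardTorus 2 L 1 0 - γ • ((pairField dWaveFormFactor L)ᴴ * pairField dWaveFormFactor L)) = ((torusBand L k + torusBand L q : ℝ) : ℂ) • (momentumCreation k 0 * momentumCreation q 1) - γ • ((pairField dWaveFormFactor L)ᴴ * (pairField dWaveFormFactor L * (momentumCreation k 0 * momentumCreation q 1) - (momentumCreation k 0 * momentumCreation q 1) * pairField dWaveFormFactor L)) :=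
  fun _ _ hL γ k q => seededH_commutator_pairCreator hL γ k q

end Summit.HubbardSuperconductivity.TwTipContinuation.IsogapTransport
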